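import Mathlib.Analysis.ODE.Gronwall
import Literature.Analysis.ODE.TorusBackwardFlow
import Literature.Analysis.FunctionSpaces.TorusInverseLaplacianCalculus
import HarnessLib

/-!
# Transport estimates on `[0,T] × T^d`: the sup norm and the gradient of the transported identity

Buckmaster–De Lellis–Székelyhidi–Vicol 2019, App. B ("Estimates for transport equations",
Prop. B.1 = Prop. 9.1 of arXiv:1701.08678): for a smooth solution of `∂ₜf + v·∇f = g`,
(B.1) `‖f(t)‖₀ ≤ ‖f(t₀)‖₀ + ∫_{t₀}^t ‖g(τ)‖₀ dτ`, and, for the inverse `Φ` of the flux of `v`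
started at `t₀` as the identity, (B.4) `‖∇Φ(t) - Id‖₀ ≲ |t - t₀| [v]₁` (for `|t - t₀|‖v‖₁ ≤ 1`).
Both are PROVED here by the method of characteristics on the slab `[0,T] × T^d`, in the within-the-
slab calculus of the tree (`Torus.IsSmoothSpaceTimeOn (Icc 0 T)`, `Torus.timeDerivWithin`,
`Torus.convect`), for velocity fields jointly smooth on the slab:

* `BackwardFlow.exists_characteristic`: through every `(t₁, y₁)` passes a (lifted) integral curve
  of `v` with `X' = ṽ(t, X)` at every `t ∈ [0,T]` (second component of the global flow of the
  clamped suspension of `TorusBackwardFlow.lean`);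
* `hasDerivWithinAt_along`: the chain rule `d/ds F(s, X(s)) = ∂ₜF + DF[X']` within `[0,T]`;
* `norm_le_of_transport` = (B.1) (bounds as predicates: `‖f(t₀, ·)‖ ≤ B₀`, `‖g(s, ·)‖ ≤ G(s)` with
  `G` continuous, conclusion `‖f(t₁, x)‖ ≤ B₀ + |∫_{t₀}^{t₁} G|`; fundamental theorem of calculus
  along the characteristic);
* `transport_partialDeriv_of_transport_id`: if `∂ₜD + (v·∇)D + v = 0` (the transport of the
  identity, `Φ = id + D`) then `∂ₜ(∂ⱼD_a) + (v·∇)(∂ⱼD_a) = -∑ₖ(∂ⱼvₖ)(∂ₖD_a) - ∂ⱼv_a` (commuting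
  `∂ₜ` and `∂ⱼ` within the slab, `Torus.timeDerivWithin_partialDeriv_comm`, and Schwarz);
* `abs_partialDeriv_le_of_transport_id` = (B.4) in the form `|∂ⱼD_a(t, x)| ≤ exp(d K |t - t₀|) - 1`
  when `|∂ⱼvₖ| ≤ K` (Grönwall, `norm_le_gronwallBound_of_norm_deriv_right_le`, forward and
  backward in time, on the matrix `(∂ⱼD_a)` along characteristics, which starts from `0` at `t₀`);
  `exp(x) - 1 ≤ (e - 1)x` for `x ≤ 1` recovers the printed `≲ |t - t₀|[v]₁`.

These are the inputs of Lemma 5.4 / Prop. 5.7 of the same paper (`‖∇Φᵢ - Id‖₀ ≤ 1/2`,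
`‖∇Φᵢ‖_N ≲ …`) for the backward flows `BDSV.FlowDisplacement` of `OnsagerBDSVPerturbation.lean`,
whose three defining properties are exactly the hypotheses used here.

## References

* T. Buckmaster, C. De Lellis, L. Székelyhidi Jr., V. Vicol, *Onsager's conjecture for admissible
  weak solutions*, Comm. Pure Appl. Math. 72 (2019) = arXiv:1701.08678, App. B, Prop. B.1,
  (B.1), (B.4). [`BuckmasterEtAl2018`]
* T. Buckmaster, C. De Lellis, P. Isett, L. Székelyhidi Jr., *Anomalous dissipation for
  `1/5`-Hölder Euler flows*, Ann. of Math. 182 (2015), App. (the detailed proofs BDSV refer to).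
  [`BuckmasterEtAl2015`]
-/

open Set Metric Filter MeasureTheory
open scoped NNReal ContDiff Topology

noncomputable section

namespace Literature.Analysis.ODE

open Literature.Analysis.FunctionSpaces Literature.Analysis.FunctionSpaces.Torus

variable {d : Type*} [Fintype d]

/-! ## Characteristics through every point of the slab -/

namespace BackwardFlow

/-- **Characteristics.** For a velocity field jointly smooth on `[0,T] × T^d` and any
`(t₁, y₁) ∈ [0,T] × ℝ^d` there is a (lifted) integral curve `X` of `v` through `y₁` at time
`t₁`, defined for all times and solving `X' = ṽ(t, X)` at every `t ∈ [0,T]` (the second component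
of the global flow of the clamped suspension). [folklore] -/
theorem exists_characteristic [DecidableEq d] {T : ℝ} (hT : 0 < T)
    {v : ℝ → UnitAddTorus d → EuclideanSpace ℝ d} (hv : IsSmoothSpaceTimeOn (Icc 0 T) v)
    (t₁ : ℝ) (y₁ : EuclideanSpace ℝ d) :
    ∃ X : ℝ → EuclideanSpace ℝ d, X t₁ = y₁ ∧ Continuous X ∧
      ∀ t ∈ Icc 0 T, HasDerivAt X (stLift v (t, X t)) t := by
  obtain ⟨K, hK⟩ := exists_lipschitzWith_clampedLift hT hv
  obtain ⟨B, hB⟩ := exists_bound_clampedLift hT hv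
  have hK' := lipschitzWith_suspension hK
  have hL' : ∀ q, ‖suspension (clampedLift hT.le v) q‖ ≤ max 1 B := norm_suspension_le hB
  set Ψ := globalFlow hK' hL' with hΨ
  refine ⟨fun t => (Ψ (t₁, y₁) (t - t₁)).2, by simp [hΨ], ?_, fun t ht => ?_⟩
  · exact continuous_snd.comp ((continuous_globalFlow hK' hL' (t₁, y₁)).comp (continuous_sub_right t₁))
  · have h1 : HasDerivAt (fun t => Ψ (t₁, y₁) (t - t₁))
        (suspension (clampedLift hT.le v) (Ψ (t₁, y₁) (t - t₁))) t := by
      have h := (hasDerivAt_globalFlow hK' hL' (t₁, y₁) (t - t₁)).scomp t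
        ((hasDerivAt_id t).sub_const t₁)
      rw [one_smul] at h
      exact h
    have h2 := ((ContinuousLinearMap.snd ℝ ℝ (EuclideanSpace ℝ d)).hasFDerivAt).comp_hasDerivAt t h1
    have hpt : Ψ (t₁, y₁) (t - t₁) = (t, (Ψ (t₁, y₁) (t - t₁)).2) := by
      refine Prod.ext ?_ rfl
      rw [fst_globalFlow_suspension]
      ring
    have h3 : (ContinuousLinearMap.snd ℝ ℝ (EuclideanSpace ℝ d))
        (suspension (clampedLift hT.le v) (Ψ (t₁, y₁) (t - t₁))) = stLift v (t, (Ψ (t₁, y₁) (t - t₁)).2) := by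
      rw [hpt, suspension_clampedLift_of_mem ht]
      rfl
    rw [h3] at h2
    exact h2

end BackwardFlow

/-! ## The chain rule along curves within the slab -/

section ChainRule

variable {G : Type*} [NormedAddCommGroup G] [NormedSpace ℝ G]

/-- **Chain rule along a curve.** For a field `F` jointly smooth on `[0,T] × T^d` and a curve
`X` with one-sided derivative `X'` within `[0,T]` at `t`,
`d/ds F(s, X(s)) = ∂ₜF(t, X(t)) + D F(t, ·)(X(t))[X']`. [folklore] -/
theorem hasDerivWithinAt_along {T : ℝ} (hT : 0 < T) {Fd : ℝ → UnitAddTorus d → G}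
    (hF : IsSmoothSpaceTimeOn (Icc 0 T) Fd) {X : ℝ → EuclideanSpace ℝ d} {X' : EuclideanSpace ℝ d}
    {t : ℝ} (ht : t ∈ Icc 0 T) (hX : HasDerivWithinAt X X' (Icc 0 T) t) :
    HasDerivWithinAt (fun s => Fd s (proj (X s)))
      (timeDerivWithin (Icc 0 T) Fd t (proj (X t)) + Torus.fderiv (Fd t) (proj (X t)) X') (Icc 0 T) t := by
  have hS : UniqueDiffOn ℝ (Icc 0 T) := uniqueDiffOn_Icc hT
  have hL : HasFDerivWithinAt (stLift Fd) (fderivWithin ℝ (stLift Fd) (Icc 0 T ×ˢ univ) (t, X t))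
      (Icc 0 T ×ˢ univ) (t, X t) :=
    (hF.differentiableOn (by simp) (t, X t) (mk_mem_prod ht (mem_univ _))).hasFDerivWithinAt
  have hc : HasDerivWithinAt (fun s => ((s, X s) : ℝ × EuclideanSpace ℝ d)) ((1 : ℝ), X') (Icc 0 T) t :=
    (hasDerivWithinAt_id t _).prodMk hX
  have hcomp := hL.comp_hasDerivWithinAt t hc (fun s hs => mk_mem_prod hs (mem_univ _))
  have heq : (fderivWithin ℝ (stLift Fd) (Icc 0 T ×ˢ univ) (t, X t)) ((1 : ℝ), X') =
      timeDerivWithin (Icc 0 T) Fd t (proj (X t)) + Torus.fderiv (Fd t) (proj (X t)) X' := by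
    rw [hF.timeDerivWithin_apply_proj hS ht (X t), hF.fderiv_slice_apply ht (X t) X',
      ← ContinuousLinearMap.map_add, Prod.mk_add_mk, add_zero, zero_add]
  rw [heq] at hcomp
  exact hcomp

end ChainRule

/-! ## The sup-norm transport estimate (BDSV App. B, Prop. B.1 (9.1)) -/

section SupNorm

variable {G : Type*} [NormedAddCommGroup G] [NormedSpace ℝ G] [CompleteSpace G]

/-- **Transport estimate in the sup norm** (Buckmaster–De Lellis–Székelyhidi–Vicol 2019, App. B,
Prop. B.1, (B.1) = (9.1) of the arXiv version: for a solution of `∂ₜf + v·∇f = g`,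
`‖f(t)‖₀ ≤ ‖f(t₀)‖₀ + ∫_{t₀}^t ‖g(τ)‖₀ dτ`). Transcription: fields jointly smooth on
`[0,T] × T^d`, the equation with the one-sided time derivative within `[0,T]`, bounds as
predicates (`‖f(t₀, x)‖ ≤ B₀`, `‖g(s, x)‖ ≤ G(s)` with `G` continuous); conclusion
`‖f(t₁, x)‖ ≤ B₀ + |∫_{t₀}^{t₁} G|` for all `t₀, t₁ ∈ [0,T]`. Proof: along the characteristic
through `(t₁, x)`, `d/ds f(s, X(s)) = g(s, X(s))`. [cite: BuckmasterEtAl2018, App. B Prop. B.1 (B.1)] -/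
theorem norm_le_of_transport {T : ℝ} (hT : 0 < T) {v : ℝ → UnitAddTorus d → EuclideanSpace ℝ d}
    (hv : IsSmoothSpaceTimeOn (Icc 0 T) v) {f g : ℝ → UnitAddTorus d → G}
    (hf : IsSmoothSpaceTimeOn (Icc 0 T) f) (hg : IsSmoothSpaceTimeOn (Icc 0 T) g)
    (heq : ∀ t ∈ Icc 0 T, ∀ x, timeDerivWithin (Icc 0 T) f t x + convect (v t) (f t) x = g t x)
    {t₀ t₁ : ℝ} (ht₀ : t₀ ∈ Icc 0 T) (ht₁ : t₁ ∈ Icc 0 T) {B₀ : ℝ} (hB₀ : ∀ x, ‖f t₀ x‖ ≤ B₀)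
    {Gb : ℝ → ℝ} (hGc : ContinuousOn Gb (Icc 0 T)) (hGb : ∀ s ∈ Icc 0 T, ∀ x, ‖g s x‖ ≤ Gb s)
    (x₁ : UnitAddTorus d) : ‖f t₁ x₁‖ ≤ B₀ + |∫ s in t₀..t₁, Gb s| := by
  classical
  obtain ⟨y₁, rfl⟩ := proj_surjective x₁
  obtain ⟨X, hX₁, hXc, hXd⟩ := BackwardFlow.exists_characteristic hT hv t₁ y₁
  -- the values of `f` and `g` along the characteristic
  set φ : ℝ → G := fun s => f s (proj (X s)) with hφ
  set ψ : ℝ → G := fun s => g s (proj (X s)) with hψ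
  have hderiv : ∀ s ∈ Icc 0 T, HasDerivWithinAt φ (ψ s) (Icc 0 T) s := by
    intro s hs
    have h := hasDerivWithinAt_along hT hf hs (hXd s hs).hasDerivWithinAt
    rwa [show timeDerivWithin (Icc 0 T) f s (proj (X s)) + Torus.fderiv (f s) (proj (X s)) (stLift v (s, X s)) =
      g s (proj (X s)) from heq s hs _] at h
  have hφc : ContinuousOn φ (Icc 0 T) := fun s hs => (hderiv s hs).continuousWithinAt
  have hψc : ContinuousOn ψ (Icc 0 T) := by
    have h1 : ContinuousOn (fun s => ((s, X s) : ℝ × EuclideanSpace ℝ d)) (Icc 0 T) :=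
      (continuous_id.prodMk hXc).continuousOn
    exact hg.continuousOn.comp h1 fun s hs => mk_mem_prod hs (mem_univ _)
  have hGψ : ∀ s ∈ Icc 0 T, ‖ψ s‖ ≤ Gb s := fun s hs => hGb s hs _
  -- fundamental theorem of calculus between `t₀` and `t₁`
  have key : ∀ a b : ℝ, a ∈ Icc 0 T → b ∈ Icc 0 T → a ≤ b →
      φ b - φ a = ∫ s in a..b, ψ s ∧ ‖∫ s in a..b, ψ s‖ ≤ ∫ s in a..b, Gb s := by
    intro a b ha hb hab
    have hsub : Icc a b ⊆ Icc 0 T := Icc_subset_Icc ha.1 hb.2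
    have hsub' : uIcc a b ⊆ Icc 0 T := by rwa [uIcc_of_le hab]
    have hint : IntervalIntegrable ψ volume a b := (hψc.mono hsub').intervalIntegrable
    constructor
    · refine (intervalIntegral.integral_eq_sub_of_hasDerivAt_of_le hab (hφc.mono hsub)
        (fun s hs => ?_) hint).symm
      have hs' : s ∈ Icc 0 T := hsub (Ioo_subset_Icc_self hs)
      exact (hderiv s hs').hasDerivAt (Icc_mem_nhds (lt_of_le_of_lt ha.1 hs.1) (lt_of_lt_of_le hs.2 hb.2))
    · refine (intervalIntegral.norm_integral_le_integral_norm hab).trans ?_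
      exact intervalIntegral.integral_mono_on hab hint.norm ((hGc.mono hsub').intervalIntegrable)
        fun s hs => hGψ s (hsub hs)
  have hφ₁ : f t₁ (proj y₁) = φ t₁ := by simp only [hφ, hX₁]
  rw [hφ₁]
  rcases le_total t₀ t₁ with h | h
  · obtain ⟨h1, h2⟩ := key t₀ t₁ ht₀ ht₁ h
    have : φ t₁ = φ t₀ + ∫ s in t₀..t₁, ψ s := by rw [← h1]; abel
    rw [this]
    refine (norm_add_le _ _).trans (add_le_add (hB₀ _) (h2.trans (le_abs_self _)))
  · obtain ⟨h1, h2⟩ := key t₁ t₀ ht₁ ht₀ h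
    have : φ t₁ = φ t₀ - ∫ s in t₁..t₀, ψ s := by rw [← h1]; abel
    rw [this, intervalIntegral.integral_symm t₁ t₀, abs_neg]
    refine (norm_sub_le _ _).trans (add_le_add (hB₀ _) (h2.trans (le_abs_self _)))

end SupNorm

/-! ## The gradient of the transported identity (BDSV App. B, (B.4) = (9.4)) -/

section GradientBound

variable [DecidableEq d]

omit [DecidableEq d] in
/-- Coordinates of vectors are bounded by the sup norm of a matrix of such vectors. [folklore] -/
theorem abs_apply_apply_le_norm (M : d → d → ℝ) (a j : d) : |M a j| ≤ ‖M‖ :=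
  (Real.norm_eq_abs _ ▸ norm_le_pi_norm (M a) j).trans (norm_le_pi_norm M a)

/-- **The differentiated transport equation.** If `∂ₜD + (v·∇)D + v = 0` on `[0,T] × T^d` for
jointly smooth `D`, `v`, then the entries `∂ⱼD_a` satisfy
`∂ₜ(∂ⱼD_a) + (v·∇)(∂ⱼD_a) = -∑ₖ (∂ⱼvₖ)(∂ₖD_a) - ∂ⱼv_a` (differentiate in `xⱼ`, commute `∂ₜ`
and `∂ⱼ`, cancel the second-order terms by Schwarz). [folklore] -/
theorem transport_partialDeriv_of_transport_id {T : ℝ} (hT : 0 < T)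
    {v D : ℝ → UnitAddTorus d → EuclideanSpace ℝ d} (hv : IsSmoothSpaceTimeOn (Icc 0 T) v)
    (hD : IsSmoothSpaceTimeOn (Icc 0 T) D)
    (htr : ∀ t ∈ Icc 0 T, ∀ x, timeDerivWithin (Icc 0 T) D t x + convect (v t) (D t) x + v t x = 0)
    {t : ℝ} (ht : t ∈ Icc 0 T) (x : UnitAddTorus d) (a j : d) :
    timeDerivWithin (Icc 0 T) (fun s y => partialDeriv j (D s) y a) t x +
        convect (v t) (fun y => partialDeriv j (D t) y a) x =
      -(∑ k, partialDeriv j (v t) x k * partialDeriv k (D t) x a) - partialDeriv j (v t) x a := by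
  have hS : UniqueDiffOn ℝ (Icc 0 T) := uniqueDiffOn_Icc hT
  have hvt : IsSmooth (v t) := hv.isSmooth_slice ht
  have hDt : IsSmooth (D t) := hD.isSmooth_slice ht
  have hvt1 : IsContDiff 1 (v t) := hvt.isContDiff (by simp)
  have hDt1 : IsContDiff 1 (D t) := hDt.isContDiff (by simp)
  -- (i)-(ii): `∂ₜ(∂ⱼD_a) = (∂ⱼ ∂ₜD)_a`
  have e1 : timeDerivWithin (Icc 0 T) (fun s y => partialDeriv j (D s) y a) t x =
      partialDeriv j (timeDerivWithin (Icc 0 T) D t) x a := by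
    have h := timeDerivWithin_clm_comp (hD.partialDeriv hS j) hS (EuclideanSpace.proj a) ht x
    simp only [PiLp.proj_apply] at h
    rw [h, timeDerivWithin_partialDeriv_comm hT hD ht j x]
  -- (iii): `∂ₜD = -((v·∇)D + v)` on the slice
  set Sfun : UnitAddTorus d → EuclideanSpace ℝ d := fun y => ∑ k, v t y k • partialDeriv k (D t) y with hSfun
  have e2 : timeDerivWithin (Icc 0 T) D t = fun y => -((Sfun + v t) y) := by
    funext y
    have h := htr t ht y
    rw [convect_eq_sum_smul_partialDeriv hDt1] at h
    rw [Pi.add_apply, hSfun]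
    exact eq_neg_of_add_eq_zero_left (by rw [← h]; abel)
  -- (iv): `∂ⱼ` of the slice identity
  have hk : ∀ k, IsSmooth (fun y => v t y k • partialDeriv k (D t) y) := fun k =>
    (hvt.apply k).smul' (hDt.partialDeriv k)
  have hsum : IsSmooth Sfun := by
    unfold IsSmooth
    exact ContDiff.sum fun k _ => hk k
  have e3 : partialDeriv j (timeDerivWithin (Icc 0 T) D t) x =
      -(∑ k, (v t x k • partialDeriv j (partialDeriv k (D t)) x +
          partialDeriv j (fun y => v t y k) x • partialDeriv k (D t) x)) - partialDeriv j (v t) x := by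
    rw [e2, partialDeriv_neg, congrFun (partialDeriv_add (hsum.isContDiff (by simp)) hvt1 j) x, Pi.add_apply,
      hSfun, partialDeriv_finset_sum _ (fun k _ => (hk k).isContDiff (by simp))]
    rw [neg_add, sub_eq_add_neg]
    congr 2
    refine Finset.sum_congr rfl fun k _ => ?_
    exact partialDeriv_smul ((hvt.apply k).isContDiff (by simp)) ((hDt.partialDeriv k).isContDiff (by simp)) j x
  -- (v): the convective term of the chain rule
  have e4 : convect (v t) (fun y => partialDeriv j (D t) y a) x =
      ∑ k, v t x k * partialDeriv j (partialDeriv k (D t)) x a := by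
    rw [convect_eq_sum_smul_partialDeriv (((hDt.partialDeriv j).apply a).isContDiff (by simp))]
    refine Finset.sum_congr rfl fun k _ => ?_
    rw [smul_eq_mul, partialDeriv_apply_coord ((hDt.partialDeriv j).isContDiff (by simp)),
      partialDeriv_comm hDt k j]
  rw [e1, e3, e4]
  simp only [PiLp.sub_apply, PiLp.neg_apply, WithLp.ofLp_sum, Finset.sum_apply, PiLp.add_apply,
    PiLp.smul_apply, smul_eq_mul, Finset.sum_add_distrib, partialDeriv_apply_coord hvt1]
  ring


/-- The Grönwall bound with zero initial datum and equal constants: `e^{kx} - 1`. [folklore] -/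
theorem gronwallBound_zero_self (k x : ℝ) : gronwallBound 0 k k x = Real.exp (k * x) - 1 := by
  by_cases hk : k = 0
  · subst hk; simp [gronwallBound_K0]
  · rw [gronwallBound_of_K_ne_0 hk]; field_simp; ring

/-- **Gradient bound for the transported identity** (Buckmaster–De Lellis–Székelyhidi–Vicol 2019,
App. B, (B.4) = (9.4): for the inverse `Φ` of the flux of `v` started at `t₀` as the identity,
`‖∇Φ(t) - Id‖₀ ≲ |t|[v]₁`, for `|t|‖v‖₁ ≤ 1`). Transcription, in the displacement form
`Φ = id + D` on `[0,T] × T^d`: if `D` is jointly smooth, `D(t₀, ·) = 0` and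
`∂ₜD + (v·∇)D + v = 0`, and `|∂ⱼvₖ| ≤ K` on `[0,T] × T^d`, then
`|∂ⱼD_a(t, x)| ≤ exp(d K |t - t₀|) - 1` for all `t ∈ [0,T]` (so `≤ (e - 1) d K |t - t₀|` when
`d K |t - t₀| ≤ 1`). Proof: along each characteristic the matrix `M = (∂ⱼD_a)` solves
`M' = -M (∂v) - (∂v)` (`transport_partialDeriv_of_transport_id`), `M(t₀) = 0`; Grönwall.
[cite: BuckmasterEtAl2018, App. B Prop. B.1 (B.4)] -/
theorem abs_partialDeriv_le_of_transport_id {T : ℝ} (hT : 0 < T)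
    {v D : ℝ → UnitAddTorus d → EuclideanSpace ℝ d} (hv : IsSmoothSpaceTimeOn (Icc 0 T) v)
    (hD : IsSmoothSpaceTimeOn (Icc 0 T) D) {t₀ : ℝ} (ht₀ : t₀ ∈ Icc 0 T) (h0 : ∀ x, D t₀ x = 0)
    (htr : ∀ t ∈ Icc 0 T, ∀ x, timeDerivWithin (Icc 0 T) D t x + convect (v t) (D t) x + v t x = 0)
    {K : ℝ} (hK0 : 0 ≤ K) (hK : ∀ s ∈ Icc 0 T, ∀ x, ∀ j k : d, |partialDeriv j (v s) x k| ≤ K)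
    {t₁ : ℝ} (ht₁ : t₁ ∈ Icc 0 T) (x₁ : UnitAddTorus d) (a j : d) :
    |partialDeriv j (D t₁) x₁ a| ≤ Real.exp (Fintype.card d * K * |t₁ - t₀|) - 1 := by
  obtain ⟨y₁, rfl⟩ := proj_surjective x₁
  obtain ⟨X, hX₁, hXc, hXd⟩ := BackwardFlow.exists_characteristic hT hv t₁ y₁
  have hS : UniqueDiffOn ℝ (Icc 0 T) := uniqueDiffOn_Icc hT
  set c : ℝ := Fintype.card d * K with hc
  have hcard : (1 : ℝ) ≤ Fintype.card d := by
    have : 0 < Fintype.card d := Fintype.card_pos_iff.2 ⟨a⟩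
    exact_mod_cast this
  have hc0 : 0 ≤ c := mul_nonneg (by linarith) hK0
  have hKc : K ≤ c := by nlinarith
  -- the matrix `M(s) = (∂ⱼ D_a)(s, X(s))` and its derivative
  set M : ℝ → d → d → ℝ := fun s a j => partialDeriv j (D s) (proj (X s)) a with hM
  set M' : ℝ → d → d → ℝ := fun s a j =>
    -(∑ k, partialDeriv j (v s) (proj (X s)) k * M s a k) - partialDeriv j (v s) (proj (X s)) a with hM'
  have hderiv : ∀ s ∈ Icc 0 T, HasDerivWithinAt M (M' s) (Icc 0 T) s := by
    intro s hs
    refine hasDerivWithinAt_pi.2 fun a' => hasDerivWithinAt_pi.2 fun j' => ?_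
    have hfield : IsSmoothSpaceTimeOn (Icc 0 T) (fun s' y => partialDeriv j' (D s') y a') :=
      (hD.partialDeriv hS j').apply a'
    have h := hasDerivWithinAt_along hT hfield hs (hXd s hs).hasDerivWithinAt
    have heq := transport_partialDeriv_of_transport_id hT hv hD htr hs (proj (X s)) a' j'
    rw [show Torus.fderiv (fun y => partialDeriv j' (D s) y a') (proj (X s)) (stLift v (s, X s)) =
      convect (v s) (fun y => partialDeriv j' (D s) y a') (proj (X s)) from rfl] at h
    rw [heq] at h
    exact h
  have hbound : ∀ s ∈ Icc 0 T, ‖M' s‖ ≤ c * ‖M s‖ + c := by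
    intro s hs
    refine (pi_norm_le_iff_of_nonneg (by positivity)).2 fun a' => (pi_norm_le_iff_of_nonneg (by positivity)).2
      fun j' => ?_
    rw [Real.norm_eq_abs]
    have h1 : |∑ k, partialDeriv j' (v s) (proj (X s)) k * M s a' k| ≤ ∑ k : d, K * ‖M s‖ := by
      refine (Finset.abs_sum_le_sum_abs _ _).trans (Finset.sum_le_sum fun k _ => ?_)
      rw [abs_mul]
      exact mul_le_mul (hK s hs _ j' k) (abs_apply_apply_le_norm (M s) a' k) (abs_nonneg _) hK0
    have h2 : |partialDeriv j' (v s) (proj (X s)) a'| ≤ K := hK s hs _ j' a'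
    calc |M' s a' j'| ≤ |∑ k, partialDeriv j' (v s) (proj (X s)) k * M s a' k| +
          |partialDeriv j' (v s) (proj (X s)) a'| := by
            rw [hM']; exact (abs_sub _ _).trans (by rw [abs_neg])
      _ ≤ (∑ k : d, K * ‖M s‖) + K := add_le_add h1 h2
      _ = c * ‖M s‖ + K := by rw [Finset.sum_const, Finset.card_univ, nsmul_eq_mul, hc]; ring
      _ ≤ c * ‖M s‖ + c := by linarith
  have hM0 : M t₀ = 0 := by
    funext a' j'
    have hD0 : D t₀ = fun _ => 0 := funext h0
    simp [hM, hD0, partialDeriv, Torus.lineDeriv]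
  have hcont : ContinuousOn M (Icc 0 T) := fun s hs => (hderiv s hs).continuousWithinAt
  -- conclusion at `t₁` from a Grönwall bound on `‖M t₁‖`
  suffices hfin : ‖M t₁‖ ≤ Real.exp (c * |t₁ - t₀|) - 1 by
    have h := abs_apply_apply_le_norm (M t₁) a j
    have hMt : M t₁ a j = partialDeriv j (D t₁) (proj y₁) a := by simp [hM, hX₁]
    rw [hMt] at h
    exact h.trans hfin
  rcases le_total t₀ t₁ with h01 | h10
  · -- forward Grönwall on `[t₀, t₁]`
    have hG := norm_le_gronwallBound_of_norm_deriv_right_le (f := M) (f' := M') (δ := 0) (K := c) (ε := c)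
      (a := t₀) (b := t₁) (hcont.mono (Icc_subset_Icc ht₀.1 ht₁.2)) (fun s hs => ?_) (by rw [hM0, norm_zero])
      (fun s hs => hbound s ⟨ht₀.1.trans hs.1, hs.2.le.trans ht₁.2⟩) t₁ ⟨h01, le_rfl⟩
    · rw [gronwallBound_zero_self] at hG
      rwa [abs_of_nonneg (sub_nonneg.2 h01)]
    · have hs' : s ∈ Icc 0 T := ⟨ht₀.1.trans hs.1, hs.2.le.trans ht₁.2⟩
      refine (hderiv s hs').mono_of_mem_nhdsWithin ?_
      exact Filter.mem_of_superset (Icc_mem_nhdsGE (lt_of_lt_of_le hs.2 ht₁.2)) (Icc_subset_Icc hs'.1 le_rfl)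
  · -- backward: Grönwall for `s ↦ M(-s)` on `[-t₀, -t₁]`
    set N : ℝ → d → d → ℝ := fun s => M (-s) with hN
    have hNd : ∀ s ∈ Ico (-t₀) (-t₁), HasDerivWithinAt N (-(M' (-s))) (Ici s) s := by
      intro s hs
      have hs' : -s ∈ Icc 0 T := ⟨by linarith [ht₁.1, hs.2], by linarith [ht₀.2, hs.1]⟩
      have h1 : HasDerivWithinAt M (M' (-s)) (Icc 0 T) (-s) := hderiv (-s) hs'
      have h2 : HasDerivWithinAt (fun s' : ℝ => -s') (-1 : ℝ) (Icc s (-t₁)) s := (hasDerivWithinAt_neg s _)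
      have h3 := h1.scomp s h2 (fun s' hs'' => ⟨by linarith [ht₁.1, hs''.2], by linarith [ht₀.2, hs''.1, hs.1]⟩)
      have h4 : HasDerivWithinAt N (-(M' (-s))) (Icc s (-t₁)) s := by
        simpa [hN, Function.comp_def] using h3
      exact h4.mono_of_mem_nhdsWithin (Icc_mem_nhdsGE hs.2)
    have hNc : ContinuousOn N (Icc (-t₀) (-t₁)) := by
      refine (hcont.comp continuous_neg.continuousOn fun s hs => ?_)
      exact ⟨by linarith [ht₁.1, hs.2], by linarith [ht₀.2, hs.1]⟩
    have hG := norm_le_gronwallBound_of_norm_deriv_right_le (f := N) (f' := fun s => -(M' (-s))) (δ := 0)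
      (K := c) (ε := c) (a := -t₀) (b := -t₁) hNc hNd (by simp [hN, hM0])
      (fun s hs => by
        rw [norm_neg]
        exact hbound (-s) ⟨by linarith [ht₁.1, hs.2], by linarith [ht₀.2, hs.1]⟩) (-t₁) ⟨by linarith, le_rfl⟩
    rw [gronwallBound_zero_self] at hG
    have : N (-t₁) = M t₁ := by simp [hN]
    rw [this] at hG
    rwa [abs_of_nonpos (sub_nonpos.2 h10), show -(t₁ - t₀) = -t₁ - -t₀ by ring]

end GradientBound

end Literature.Analysis.ODE
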